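import Summits.CriticalPhenomena.Ising3DConformalLimit.Theorems.EnergyNotSigmaSquaredGapForcesFarMergingUnpinchedEnvelope
import Summits.CriticalPhenomena.Ising3DConformalLimit.Theorems.GapForcesFarMerging.Negative.LineShapes
import Summits.CriticalPhenomena.Ising3DConformalLimit.Theorems.MoebiusLimitExists.Negative.PinnedClusterPoints

/-!
# A-priori bounds on the single-pinch avoidance functional of line `rp-unpinch-single-passage`
# (crux `GapForcesFarMerging`, item stmt-CriticalPhenomena-4468; drefute generation 2, stub `stub_quasiMultiplicative`)

For the critical nearest-neighbour Ising model on `ℤ³`, the opened-pinch truncation of the line,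
`T(s e₂; m) = ⟨σ₀σ_{s e₂} ; σ_{up m}σ_{dn m}⟩` with `up m = (2m,m,0)`, `dn m = (2m,-m,0)`, obeys

  `T(s e₂; m) ≤ 2 · ⟨σ₀σ_{dn m}⟩⟨σ_{s e₂}σ_{up m}⟩ = 2 · Npar(s e₂; m)`   for `0 ≤ s ≤ m`,

i.e. the avoidance functional `𝒜(s e₂; m) = T/Npar` of stub 4 (`QuasiMultiplicativeShape`) lies in
`[0, 2]`: Lebowitz' inequality bounds the truncation by the two other pairings
(`pairPairTruncation_le_pairings`), the parallel one IS `Npar`, and the crossed one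
`⟨σ₀σ_{up m}⟩⟨σ_{se₂}σ_{dn m}⟩` is at most `Npar` because `⟨σ₀σ_{up m}⟩ = ⟨σ₀σ_{dn m}⟩` (reflection
`x₁ ↦ -x₁`) and `⟨σ_{se₂}σ_{dn m}⟩ = G(2me₁ + (m+s)e₂) ≤ G(2me₁ + (m-s)e₂) = ⟨σ_{se₂}σ_{up m}⟩`
(Messager–Miracle-Solé along the second axis). Consequently the quasi-multiplicativity quotient
`Q(s,m) = 𝒜(e₂;m) / (𝒜(e₂;s)·𝒜(se₂;m))` is at least `𝒜(e₂;m)/4`: stub 4 can only fail through the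
decay of the adjacent avoidance `𝒜(e₂;m)` itself (which GAP forces, via the landed stubs 1–2), never
through its opened factor. These are refuter-side a-priori facts for the lead; they assert no Theses
declaration.

## References

* J. L. Lebowitz, Comm. Math. Phys. 35 (1974) 87–92, Theorem, eq. (2.5b) [Lebowitz1974].
* A. Messager, S. Miracle-Solé, J. Stat. Phys. 17 (1977) 245–262, main theorem [MessagerMiracleSoleJSP1977].
-/

noncomputable section

namespace Summit.CriticalPhenomena.Ising3DConformalLimit.Theorems.GapForcesFarMerging.Negative

open Literature.Probability.LatticeModels
open Summit.CriticalPhenomena.Ising3DConformalLimit.EnergyNotSigmaSquaredGapForcesFarMerging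
  (pairPairTruncation_le_pairings criticalTwoPoint_axis_sub_single_one_eq pairPairTruncation_nonneg)
open Summit.CriticalPhenomena.Ising3DConformalLimit.PinnedClusterPoints (criticalTwoPoint_pos3)

/-- Messager–Miracle-Solé for the crossed pairing of the opened pinch: for `0 ≤ s ≤ m`,
`G(2me₁ - (m+s)e₂) ≤ G(2me₁ + (m-s)e₂)`, i.e. `⟨σ_{se₂}σ_{dn m}⟩ ≤ ⟨σ_{se₂}σ_{up m}⟩`.
[cite: MessagerMiracleSoleJSP1977, main theorem (monotonicity of ⟨σ₀σ_x⟩ under reflections)] -/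
theorem criticalTwoPoint_crossed_le_parallel {s m : ℕ} (hsm : s ≤ m) :
    criticalTwoPoint 3 (Pi.single 0 (2 * (m : ℤ)) - Pi.single 1 ((m : ℤ) + s)) ≤
      criticalTwoPoint 3 (Pi.single 0 (2 * (m : ℤ)) + Pi.single 1 ((m : ℤ) - s)) := by
  rw [criticalTwoPoint_axis_sub_single_one_eq]
  have h0 : (0 : ℤ) ≤ (Pi.single 0 (2 * (m : ℤ)) + Pi.single 1 ((m : ℤ) - s) : Site 3) 1 := by
    simp; omega
  have key := twoPointPlus_add_single_le messager_miracleSole_holds (criticalBeta_nonneg 3)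
    (Pi.single 0 (2 * (m : ℤ)) + Pi.single 1 ((m : ℤ) - s) : Site 3) 1 h0 (2 * s)
  have heq : (Pi.single 0 (2 * (m : ℤ)) + Pi.single 1 ((m : ℤ) - s) : Site 3) + Pi.single 1 (((2 * s : ℕ) : ℤ)) =
      Pi.single 0 (2 * (m : ℤ)) + Pi.single 1 ((m : ℤ) + s) := by
    rw [add_assoc, ← Pi.single_add,
      show ((m : ℤ) - s + ((2 * s : ℕ) : ℤ)) = (m : ℤ) + s by push_cast; ring]
  rw [heq] at key
  exact key

/-- **Lebowitz + MMS a-priori bound for the opened single-pinch truncation**: for `0 ≤ s ≤ m`,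
`⟨σ₀σ_{se₂} ; σ_{up m}σ_{dn m}⟩_{β_c} ≤ 2⟨σ₀σ_{dn m}⟩_{β_c}⟨σ_{se₂}σ_{up m}⟩_{β_c}` on `ℤ³`.
[cite: Lebowitz1974, Theorem, eq. (2.5b)] -/
theorem TS_src_le_two_mul_NparS {s m : ℕ} (hsm : s ≤ m) :
    TS cc2 (criticalCorr 3 4) (src s) m ≤ 2 * NparS cc2 (src s) m := by
  have hL := pairPairTruncation_le_pairings 0 (src s) (up m) (dn m)
  have h1 : up m - (0 : Site 3) = Pi.single 0 (2 * (m : ℤ)) + Pi.single 1 (m : ℤ) := by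
    rw [sub_zero]; rfl
  have h2 : dn m - src s = Pi.single 0 (2 * (m : ℤ)) - Pi.single 1 ((m : ℤ) + s) := by
    simp only [dn, xR, src]
    rw [sub_sub, ← Pi.single_add]
  have h3 : dn m - (0 : Site 3) = Pi.single 0 (2 * (m : ℤ)) - Pi.single 1 (m : ℤ) := by
    rw [sub_zero]; rfl
  have h4 : up m - src s = Pi.single 0 (2 * (m : ℤ)) + Pi.single 1 ((m : ℤ) - s) := by
    simp only [up, xR, src]
    rw [add_sub_assoc, ← Pi.single_sub]
  have hN : NparS cc2 (src s) m =
      criticalTwoPoint 3 (Pi.single 0 (2 * (m : ℤ)) - Pi.single 1 (m : ℤ)) *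
        criticalTwoPoint 3 (Pi.single 0 (2 * (m : ℤ)) + Pi.single 1 ((m : ℤ) - s)) := by
    simp only [NparS, cc2, criticalCorr_two_pair]
    rw [h3, h4]
  have hud : criticalTwoPoint 3 (Pi.single 0 (2 * (m : ℤ)) + Pi.single 1 (m : ℤ)) =
      criticalTwoPoint 3 (Pi.single 0 (2 * (m : ℤ)) - Pi.single 1 (m : ℤ)) :=
    (criticalTwoPoint_axis_sub_single_one_eq _ _).symm
  have hcross := criticalTwoPoint_crossed_le_parallel hsm
  have hGd : 0 ≤ criticalTwoPoint 3 (Pi.single 0 (2 * (m : ℤ)) - Pi.single 1 (m : ℤ)) :=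
    criticalTwoPoint_nonneg' _
  rw [h1, h2, h3, h4, hud] at hL
  change criticalCorr 3 4 ![0, src s, up m, dn m] - cc2 0 (src s) * cc2 (up m) (dn m) ≤ 2 * NparS cc2 (src s) m
  rw [hN]
  have hmul := mul_le_mul_of_nonneg_left hcross hGd
  change criticalCorr 3 4 ![0, src s, up m, dn m] - criticalCorr 3 2 ![0, src s] * criticalCorr 3 2 ![up m, dn m] ≤ _
  linarith

/-- **The opened avoidance functional lies in `[0, 2]`**: `0 ≤ 𝒜(se₂; m) ≤ 2` for `0 ≤ s ≤ m`
(GKS II for the lower bound). [cite: Lebowitz1974, Theorem, eq. (2.5b)] -/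
theorem avoidS_src_mem_Icc {s m : ℕ} (hsm : s ≤ m) :
    avoidS cc2 (criticalCorr 3 4) (src s) m ∈ Set.Icc (0 : ℝ) 2 := by
  have hNpos : 0 < NparS cc2 (src s) m := by
    simp only [NparS, cc2, criticalCorr_two_pair]
    exact mul_pos (criticalTwoPoint_pos3 _) (criticalTwoPoint_pos3 _)
  have hT0 : 0 ≤ TS cc2 (criticalCorr 3 4) (src s) m := pairPairTruncation_nonneg 0 (src s) (up m) (dn m)
  refine ⟨div_nonneg hT0 hNpos.le, ?_⟩
  change TS cc2 (criticalCorr 3 4) (src s) m / NparS cc2 (src s) m ≤ 2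
  rw [div_le_iff₀ hNpos]
  exact TS_src_le_two_mul_NparS hsm

/-- `src 1 = e₂`. [folklore] -/
theorem src_one : src 1 = e₂ := by
  simp [src, e₂]

/-- The adjacent instance: `0 ≤ 𝒜(e₂; m) ≤ 2` for `m ≥ 1`. [cite: Lebowitz1974, Theorem, eq. (2.5b)] -/
theorem avoidS_e₂_mem_Icc {m : ℕ} (hm : 1 ≤ m) :
    avoidS cc2 (criticalCorr 3 4) e₂ m ∈ Set.Icc (0 : ℝ) 2 := by
  rw [← src_one]; exact avoidS_src_mem_Icc hm

/-- **Where stub 4 can fail.** The quasi-multiplicativity quotient dominates the adjacent avoidance: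
`𝒜(e₂;s)·𝒜(se₂;m) ≤ 4`, hence for every `c > 0`, `c·𝒜(e₂;s)·𝒜(se₂;m) ≤ 𝒜(e₂;m)` holds as soon as
`4c ≤ 𝒜(e₂;m)`; in particular `QuasiMultiplicativeShape` at the critical correlators would follow from
a uniform lower bound `inf_{m ≥ 1} 𝒜(e₂;m) > 0` (which the GAP hypothesis of the crux excludes along good
scales — the content of stub 4 is entirely in the decaying regime of `𝒜(e₂;·)`). [folklore] -/
theorem quasiMultiplicative_of_avoid_lower_bound {a : ℝ} (ha : 0 < a)
    (h : ∀ m : ℕ, 1 ≤ m → a ≤ avoidS cc2 (criticalCorr 3 4) e₂ m) :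
    QuasiMultiplicativeShape cc2 (criticalCorr 3 4) := by
  refine ⟨a / 4, by positivity, fun s m hs hsm => ?_⟩
  have hm : 1 ≤ m := by omega
  have hsle : s ≤ m := by omega
  obtain ⟨h1l, h1u⟩ := avoidS_e₂_mem_Icc hs
  obtain ⟨h2l, h2u⟩ := avoidS_src_mem_Icc (s := s) (m := m) hsle
  have hA := h m hm
  have hprod : avoidS cc2 (criticalCorr 3 4) e₂ s * avoidS cc2 (criticalCorr 3 4) (src s) m ≤ 4 := by
    nlinarith
  calc a / 4 * avoidS cc2 (criticalCorr 3 4) e₂ s * avoidS cc2 (criticalCorr 3 4) (src s) m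
      = a / 4 * (avoidS cc2 (criticalCorr 3 4) e₂ s * avoidS cc2 (criticalCorr 3 4) (src s) m) := by ring
    _ ≤ a / 4 * 4 := by gcongr
    _ = a := by ring
    _ ≤ avoidS cc2 (criticalCorr 3 4) e₂ m := hA

end Summit.CriticalPhenomena.Ising3DConformalLimit.Theorems.GapForcesFarMerging.Negative

end
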